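import Summits.QuantumFields.YangMills.Theorems.IR.ShellMaxCorrRung
import Literature.MathematicalPhysics.QuantumFieldTheory.Balaban1983to89.StrongCouplingTorusWindow

/-!
# Crux `IR` (item stmt-QuantumFields-19354) — merged line «maximal correlation at one physical thickness»:
# THE COLLAR RUNG `stub_collarRungSC : CollarRungSC` (strong-coupling instance of the collar format at width 3)

`--supports stmt-QuantumFields-19354` (helper; the file closes no item; lead prover ym-ir-line-mxc-p1 g3; director-ym R363 merged
the collar line «collar-decoupling» of ideator ym-ir-idea-5 into the maxcorr line, R366 (ii): engines / seams / rungs only).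

**Statement proved** (§0 `CollarRungSC`, made a tree constant HERE, VERBATIM the collar skeleton's v1.1 stub requested by critic
ym-ir-crit-1 (4b); the merged line's vocabulary module `Theorems/IR/ShellMaxCorrDefs.lean` §0 carries `CollarDecouplingAt` and
`CollarCriterion` but not this rung statement): `CollarRungSC` — for every compact simple `G` and lattice representation `r` there is `β_D > 0` such that for
`0 < β ≤ β_D`, `CollarDecouplingAt r.ρ β 3` (`Theorems/IR/ShellMaxCorrDefs.lean` §0): on every odd torus, for every cube `Λ_R(c)` and
every bounded measurable statistic `f` of its links there is a surrogate `f'`, local in `Λ_{R+5}(c)`, with `∫ (f − f') h dμ = 0` for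
every bounded statistic `h` of the exterior of `Λ_{R+3}(c)` and `∫ (f' − ∫ f)² dμ ≤ ¼ ∫ (f − ∫ f)² dμ` under the torus Wilson measure.

**Proof.**  §2 `exists_strongCoupling_surrogate` is the W-GENERIC form of the lead's g2 rung route: for ANY finite link set `W`
the kernel average `γ_W f` of the torus weight specification of `v_β = exp(−β(n − Re tr ρ))` (= `E_μ[f | links off W]`, DLR:
`ShellMaxCorr.HeatBath.integral_kernelAvg[_mul]`) has variance `≤ ¼ Var f` for `|β| ≤ β₀(ρ)` by (P) Dobrushin ⇒ Poincaré +
(B) Bessel/Schur (`ShellMaxCorr.HeatBath.integral_sq_kernelAvg_sub_le`, `Theorems/IR/ShellMaxCorrTransfer.lean`) with the torus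
inputs (H1)(H2) `…ShellMaxCorrBoundaryTilt.lean`, (H3) `…ShellMaxCorrTorusGram.lean` — the SAME `β₀(ρ)` and the same lines as
`ShellMaxCorr.stub_shellRung` (which is the case `W = {links not outside B_{R+1}}`); its LOCALITY in the plaquette closure of `W`
is the Markov property of the torus weight specification, `Literature…StrongCouplingTorusWindow.dependsOn_specAvg_torusWeightSpec`.
§1: the plaquette closure of the cube `Λ_{R+3}(c)` lies in `Λ_{R+4}(c) ⊆ Λ_{R+5}(c)` (periodic triangle inequality).  §3 assembles
(`W = cubeEdgesF S c (R+3)`; metrisability of `G` from `r`; simplicity unused).  §0's `def CollarRungSC : Prop` is a line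
statement (the skeleton's stub type), not a literature fact; it is proved in §3, so nothing in this file is asserted.

HONEST FRAMING: a strong-coupling (`β ≤ β_D(ρ)`, tiny and inexplicit) statement about finite tori — the BC5 format rung of the
collar typing of a CONDITIONAL rung line; it says nothing at weak coupling: the loads `CollarSharpOnset` / `stub_shellCert :
IRShellCorr`, the crux `IR`, and the Clay Yang–Mills mass gap are untouched (R4 closes only the finite-𝕋⁴ rung `BalabanLadder.UV`).

Refs: collar card `Cruxes/IR/Lines/collar-decoupling.md` v1.1 (§Stubs, crit-1 (4b)); Georgii, *Gibbs Measures and Phase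
Transitions* (2011) Def. 2.9, Prop. 8.8; L. Wu, Ann. Probab. 34 (2006) 1960 (Poincaré under Dobrushin); Friedli–Velenik (2017)
§6.3 (Markov property of finite-range specifications).
-/

set_option autoImplicit false

noncomputable section

open MeasureTheory ProbabilityTheory Finset Function Filter Real Topology
open Literature.Probability.LatticeModels Literature.Probability.LatticeModels.DobrushinMetric
open Literature.MathematicalPhysics.QuantumLattice (groupHeatKernelMeasure)
open Literature.MathematicalPhysics.QuantumFieldTheory
open Literature.MathematicalPhysics.QuantumFieldTheory.Balaban1983to89.StrongCouplingTorusWindow (specAvg plaqClosure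
  dependsOn_specAvg_torusWeightSpec exists_near_of_mem_plaqClosure)
open Summit.QuantumFields.YangMills.Cruxes.IR.ShellMaxCorr.HeatBath
open Summit.QuantumFields.YangMills.Cruxes.IR.ShellMaxCorr.TorusTilt

namespace Summit.QuantumFields.YangMills.Cruxes.IR.CollarDecoupling

/-! ## §0 The rung statement of the collar skeleton (v1.1), verbatim -/

/-- **RUNG of the collar line (BC5-style; skeleton stub `stub_collarRungSC`, size M) — the strong-coupling / Dobrushin
instance of the collar format at width `3`**: for every compact simple `G` and lattice representation `r` there is `β_D > 0`
such that for `0 < β ≤ β_D` the torus Wilson measure decouples (orthogonality surrogate local in the fattened cube, variance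
`≤ ¼`, i.e. maximal correlation `≤ ½`) across every cubical collar of width `3`, on every odd torus and every inner radius
(`CollarDecouplingAt r.ρ β 3` of `Theorems/IR/ShellMaxCorrDefs.lean`).  A witness OUTSIDE `IR`'s `β → ∞` regime: it exercises the
FORMAT where the leaf question is moot and is no evidence for the load.  (Verbatim the skeleton's statement; PROVED below,
`stub_collarRungSC`.) -/
def CollarRungSC : Prop :=
  ∀ (G : Type) [Group G] [TopologicalSpace G] [IsTopologicalGroup G] [CompactSpace G],
    IsCompactSimpleLieGroup G → letI : MeasurableSpace G := borel G; haveI : BorelSpace G := ⟨rfl⟩;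
    ∀ r : LatticeRep G, ∃ β_D : ℝ, 0 < β_D ∧ ∀ β : ℝ, 0 < β → β ≤ β_D → CollarDecouplingAt r.ρ β 3

end Summit.QuantumFields.YangMills.Cruxes.IR.CollarDecoupling

namespace Summit.QuantumFields.YangMills.Cruxes.IR.CollarDecoupling

/-! ## §1 Cubes as finite link sets and their plaquette closures -/

section Cubes

/-- The links based in the cube `Λ_R(c)` as a `Finset` (the set `cubeEdges S c R` of the Defs file). -/
def cubeEdgesF (S : ℕ) (c : Site 4 (2 * S + 1)) (R : ℕ) : Finset (Edge 4 (2 * S + 1)) :=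
  Finset.univ.filter fun e => ∀ i, ((e.1 i - c i).valMinAbs).natAbs ≤ R

/-- Membership in `cubeEdgesF` is membership in `cubeEdges`. -/
theorem mem_cubeEdgesF {S : ℕ} {c : Site 4 (2 * S + 1)} {R : ℕ} {e : Edge 4 (2 * S + 1)} :
    e ∈ cubeEdgesF S c R ↔ e ∈ cubeEdges S c R := by
  simp [cubeEdgesF, cubeEdges, cubeSites]

/-- `↑(cubeEdgesF S c R) = cubeEdges S c R`. -/
theorem coe_cubeEdgesF (S : ℕ) (c : Site 4 (2 * S + 1)) (R : ℕ) :
    (↑(cubeEdgesF S c R) : Set (Edge 4 (2 * S + 1))) = cubeEdges S c R :=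
  Set.ext fun _ => mem_cubeEdgesF

/-- Cubes grow with the radius. -/
theorem cubeEdges_mono (S : ℕ) (c : Site 4 (2 * S + 1)) {R R' : ℕ} (h : R ≤ R') :
    cubeEdges S c R ⊆ cubeEdges S c R' := fun _ he i => (he i).trans h

/-- **The plaquette closure of a cube lies in the next cube**: every link of a plaquette through a link based in `Λ_R(c)` is
based in `Λ_{R+1}(c)` (periodic triangle inequality, coordinatewise). -/
theorem plaqClosure_cubeEdgesF_subset (S : ℕ) (c : Site 4 (2 * S + 1)) (R : ℕ) :
    (↑(plaqClosure (cubeEdgesF S c R)) : Set (Edge 4 (2 * S + 1))) ⊆ cubeEdges S c (R + 1) := by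
  intro y hy
  obtain ⟨y₀, hy₀, hnear⟩ := exists_near_of_mem_plaqClosure (Finset.mem_coe.1 hy)
  have hy₀' : y₀ ∈ cubeEdges S c R := mem_cubeEdgesF.1 hy₀
  intro i
  have h1 : ((y.1 i - y₀.1 i).valMinAbs).natAbs ≤ 1 :=
    (natAbs_valMinAbs_le_torusNorm (y.1 - y₀.1) i).trans hnear
  have h2 : ((y₀.1 i - c i).valMinAbs).natAbs ≤ R := hy₀' i
  have hsum : y.1 i - c i = (y.1 i - y₀.1 i) + (y₀.1 i - c i) := by abel
  rw [hsum]
  exact (ZMod.natAbs_valMinAbs_add_le _ _).trans (by omega)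

end Cubes

/-! ## §2 The W-generic strong-coupling decoupling surrogate (kernel average under Dobrushin's condition) -/

section Surrogate

variable {G : Type} [Group G] [TopologicalSpace G] [IsTopologicalGroup G] [CompactSpace G]
  [MeasurableSpace G] [BorelSpace G]

/-- **Strong-coupling decoupling surrogate for an ARBITRARY finite link set `W`.**  For a compact metrisable gauge group and a
continuous representation `ρ` there is `β₀ > 0` such that for `|β| ≤ β₀`, on every odd torus, every bounded measurable `f`
reading only the links of `W` has a surrogate `f'` (the kernel average `γ_W f` of the torus weight specification of
`v_β = exp(−β Re tr(n − ρ))`) which is bounded by the same constant, measurable, reads only the PLAQUETTE CLOSURE of `W`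
(Markov property, `dependsOn_specAvg_torusWeightSpec`), replaces `f` against every bounded statistic blind to `W` (DLR), has the
same mean, and has variance `≤ ¼ Var f` — the last by the lead's g2 route (P)+(B)+(H1)–(H3):
`ShellMaxCorr.HeatBath.integral_sq_kernelAvg_sub_le` fed with the torus inputs of `…BoundaryTilt` / `…TorusGram`, at the SAME
smallness `β₀(ρ)` as the maxcorr rung `stub_shellRung` (whose proof is the case `W = {links not outside B_{R+1}}`). -/
theorem exists_strongCoupling_surrogate [T2Space G] [SecondCountableTopology G] {n : ℕ}
    (ρ : G →* Matrix (Fin n) (Fin n) ℂ) (hρ : Continuous ρ) :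
    ∃ β₀ : ℝ, 0 < β₀ ∧ ∀ β : ℝ, |β| ≤ β₀ → ∀ (S : ℕ) (W : Finset (Edge 4 (2 * S + 1)))
      (f : GaugeConfig 4 (2 * S + 1) G → ℝ), Measurable f → ∀ Cf : ℝ, (∀ U, |f U| ≤ Cf) →
      DependsOn f (↑W : Set (Edge 4 (2 * S + 1))) →
      ∃ f' : GaugeConfig 4 (2 * S + 1) G → ℝ, Measurable f' ∧ (∀ U, |f' U| ≤ Cf) ∧
        DependsOn f' (↑(plaqClosure W) : Set (Edge 4 (2 * S + 1))) ∧
        (∀ g : GaugeConfig 4 (2 * S + 1) G → ℝ, Measurable g → (∃ Cg, ∀ U, |g U| ≤ Cg) →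
          DependsOn g ((↑W : Set (Edge 4 (2 * S + 1)))ᶜ) →
            ∫ U, (f U - f' U) * g U ∂(wilsonMeasure (d := 4) (L := 2 * S + 1) ρ β) = 0) ∧
        (∫ U, f' U ∂(wilsonMeasure (d := 4) (L := 2 * S + 1) ρ β) =
            ∫ U, f U ∂(wilsonMeasure (d := 4) (L := 2 * S + 1) ρ β)) ∧
        ∫ U, (f' U - ∫ V, f V ∂(wilsonMeasure (d := 4) (L := 2 * S + 1) ρ β)) ^ 2
            ∂(wilsonMeasure (d := 4) (L := 2 * S + 1) ρ β) ≤
          (1 / 4) * ∫ U, (f U - ∫ V, f V ∂(wilsonMeasure (d := 4) (L := 2 * S + 1) ρ β)) ^ 2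
            ∂(wilsonMeasure (d := 4) (L := 2 * S + 1) ρ β) := by
  classical
  -- a bound on `Re tr ρ`
  have hcont : Continuous fun g : G => (ρ g).trace.re := Complex.continuous_re.comp hρ.matrix_trace
  obtain ⟨Mρ, hMρ⟩ := isCompact_univ.exists_bound_of_continuousOn hcont.continuousOn
  have hMρ' : ∀ g : G, |(ρ g).trace.re| ≤ Mρ := fun g => by simpa [Real.norm_eq_abs] using hMρ g (Set.mem_univ g)
  have hMρ0 : 0 ≤ Mρ := (abs_nonneg _).trans (hMρ' 1)
  set cρ : ℝ := 2 * Mρ with hcρ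
  -- the smallness function (everything in terms of `δ = cρ |β|`), as in `ShellMaxCorr.stub_shellRung`
  set Lf : ℝ → ℝ := fun δ => 8 * ((4 - 1 : ℕ) : ℝ) *
      ((Real.exp (2 * ((4 - 1 : ℕ) : ℝ) * δ) - Real.exp (-(2 * ((4 - 1 : ℕ) : ℝ) * δ))) ^ 2 +
        Real.exp (2 * ((4 - 1 : ℕ) : ℝ) * δ) *
          (Real.exp (2 * ((4 - 1 : ℕ) : ℝ) * δ) - Real.exp (-(2 * ((4 - 1 : ℕ) : ℝ) * δ))) *
            (((4 : ℕ) : ℝ) * ((1 + 2 * (3 : ℝ) ^ (4 : ℕ)) * (9 * δ)))) with hLf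
  set Ψ : ℝ → ℝ := fun δ => Real.exp (2 * ((4 - 1 : ℕ) : ℝ) * δ) * Lf δ *
      Real.exp (2 * (2 * ((4 - 1 : ℕ) : ℝ) * δ)) - 1 / 4 * (1 - 9 * δ) with hΨ
  have hΨc : ContinuousAt Ψ 0 := by
    have : Continuous Ψ := by
      simp only [hΨ, hLf]
      fun_prop
    exact this.continuousAt
  have hΨ0 : Ψ 0 < 0 := by simp [hΨ, hLf]
  obtain ⟨ε₁, hε₁, hΨneg⟩ := ShellMaxCorr.exists_pos_forall_lt_of_continuousAt hΨc hΨ0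
  -- `β₀`
  set β₀ : ℝ := min (ε₁ / (2 * (cρ + 1))) (1 / (1458 * (cρ + 1))) with hβ₀
  have hcρ1 : 0 < cρ + 1 := by positivity
  have hβ₀pos : 0 < β₀ := lt_min (by positivity) (by positivity)
  refine ⟨β₀, hβ₀pos, fun β hβ S W f hfm Cf hfC hfW => ?_⟩
  -- the weight and its oscillation
  set δ : ℝ := cρ * |β| with hδ
  have hδ0 : 0 ≤ δ := by positivity
  have hδε : |δ| < ε₁ := by
    rw [abs_of_nonneg hδ0, hδ]
    have h1 : |β| ≤ ε₁ / (2 * (cρ + 1)) := hβ.trans (min_le_left _ _)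
    calc cρ * |β| ≤ cρ * (ε₁ / (2 * (cρ + 1))) := mul_le_mul_of_nonneg_left h1 (by positivity)
      _ < ε₁ := by
          rw [mul_div_assoc']
          rw [div_lt_iff₀ (by positivity)]
          nlinarith
  have hδsmall : (3 : ℝ) ^ 4 * (9 * δ) ≤ 1 / 2 := by
    have h1 : |β| ≤ 1 / (1458 * (cρ + 1)) := hβ.trans (min_le_right _ _)
    have h2 : cρ * |β| ≤ cρ * (1 / (1458 * (cρ + 1))) := mul_le_mul_of_nonneg_left h1 (by positivity)
    have h3 : cρ * (1 / (1458 * (cρ + 1))) ≤ 1 / 1458 := by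
      rw [mul_one_div, div_le_div_iff₀ (by positivity) (by positivity)]
      nlinarith
    rw [hδ]; norm_num; linarith
  have hα1 : 9 * δ < 1 := by norm_num at hδsmall; linarith
  have hΨδ : Real.exp (2 * ((4 - 1 : ℕ) : ℝ) * δ) * Lf δ * Real.exp (2 * (2 * ((4 - 1 : ℕ) : ℝ) * δ)) ≤
      1 / 4 * (1 - 9 * δ) := by
    have := hΨneg δ hδε; simp only [hΨ] at this; linarith
  -- the single-plaquette weight
  set v : G → ℝ := fun g => Real.exp (-(β * ((n : ℝ) - (ρ g).trace.re))) with hv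
  have hvc : Continuous v := (((continuous_const.sub hcont).const_mul β).neg).rexp
  have hv0 : ∀ g, 0 < v g := fun g => Real.exp_pos _
  have hvδ : ∀ a b, |Real.log (v a) - Real.log (v b)| ≤ δ := by
    intro a b
    simp only [hv, Real.log_exp]
    have h1 := hMρ' a
    have h2 := hMρ' b
    calc |-(β * ((n : ℝ) - (ρ a).trace.re)) - -(β * ((n : ℝ) - (ρ b).trace.re))|
        = |β| * |(ρ a).trace.re - (ρ b).trace.re| := by
          rw [← abs_mul]; congr 1; ring
      _ ≤ |β| * (Mρ + Mρ) := by
          refine mul_le_mul_of_nonneg_left ((abs_sub _ _).trans (add_le_add h1 h2)) (abs_nonneg _)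
      _ = δ := by rw [hδ, hcρ]; ring
  -- the torus, the measure, the specification
  set μ : Measure (GaugeConfig 4 (2 * S + 1) G) := wilsonMeasure (d := 4) (L := 2 * S + 1) ρ β with hμ
  have hμeq : μ = groupHeatKernelMeasure (d := 4) (L := 2 * S + 1) (fun _ : ℝ => v) 0 :=
    ShellMaxCorr.wilsonMeasure_eq_groupHeatKernelMeasure_rep (d := 4) (L := 2 * S + 1) ρ β
  have hγ : IsSpecification (torusWeightSpec (d := 4) (L := 2 * S + 1) v) := isSpecification_torusWeightSpec hvc hv0
  have hGibbs : IsGibbsMeasure (torusWeightSpec (d := 4) (L := 2 * S + 1) v) μ := by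
    rw [hμeq]; exact isGibbsMeasure_groupHeatKernelMeasure hvc hv0
  haveI : IsProbabilityMeasure μ := hGibbs.isProbabilityMeasure
  have hC := isKRContraction_torusWeightSpec_linear (d := 4) (L := 2 * S + 1) hvc hv0 hvδ
  have hrow : ∀ x : Edge 4 (2 * S + 1), ∑ y ∈ linkNbrT x, (jointPlaq x y : ℝ) * δ / 2 ≤ 9 * δ := fun x => by
    have h := sum_linkNbrT_coeff_le_linear (d := 4) (L := 2 * S + 1) hδ0 x
    norm_num at h
    linarith
  have hα9 : 3 * (4 - 1 : ℕ) * δ ≤ 9 * δ := by norm_num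
  -- the kernel average `h = γ_W f` (the surrogate)
  set h : GaugeConfig 4 (2 * S + 1) G → ℝ := fun η => ∫ σ, f σ ∂(torusWeightSpec (d := 4) (L := 2 * S + 1) v W η) with hh
  have hhm : Measurable h := measurable_kernelAvg hγ W hfm
  have hhC : ∀ η, |h η| ≤ Cf := hγ.abs_integral_le W hfC
  have hD0 : (0 : ℝ) ≤ 2 * ((4 - 1 : ℕ) : ℝ) * δ := by positivity
  have hgap : 0 ≤ Real.exp (2 * ((4 - 1 : ℕ) : ℝ) * δ) - Real.exp (-(2 * ((4 - 1 : ℕ) : ℝ) * δ)) :=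
    sub_nonneg.2 (Real.exp_le_exp.2 (by linarith))
  have hLf0 : 0 ≤ Lf δ := by
    simp only [hLf]
    exact mul_nonneg (by positivity) (add_nonneg (sq_nonneg _)
      (mul_nonneg (mul_nonneg (Real.exp_pos _).le hgap) (by positivity)))
  -- (P)+(B)+(H1)+(H2)+(H3): the variance transfer
  have key := integral_sq_kernelAvg_sub_le (γ := torusWeightSpec (d := 4) (L := 2 * S + 1) v) hγ hC hrow hGibbs W
    (haarProbability G) (K := Real.exp (2 * ((4 - 1 : ℕ) : ℝ) * δ)) (Real.exp_pos _).le
    (fun x η φ hφm hφ0 hφb => integral_siteLaw_torusWeightSpec_le (d := 4) (L := 2 * S + 1) hvc hv0 hvδ x η φ hφm hφ0 hφb)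
    (fun e s σ => Real.exp (torusLogWeight v (update σ e s) - torusLogWeight v σ))
    (fun e s => measurable_exp_update_sub hvc e s) (ρlo := Real.exp (-(2 * ((4 - 1 : ℕ) : ℝ) * δ)))
    (ρhi := Real.exp (2 * ((4 - 1 : ℕ) : ℝ) * δ)) (Real.exp_pos _)
    (fun e s σ => exp_update_sub_bounds (d := 4) (L := 2 * S + 1) hvδ e s σ)
    (fun x hx s η F hFm _ hF => integral_torusWeightSpec_update_boundary_of_dependsOn hvc hv0 W hx s η F hFm hF)
    (Λ := Lf δ) hLf0
    (fun η sel x _ => gramRow_torusWeightSpec_le (d := 4) (L := 2 * S + 1) hvc hv0 hvδ hα9 hδsmall W η sel x)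
    hfm hfC hfW
  -- `Var h ≤ ¼ Var f`
  have hquot : Real.exp (2 * ((4 - 1 : ℕ) : ℝ) * δ) * Lf δ / Real.exp (-(2 * ((4 - 1 : ℕ) : ℝ) * δ)) ^ 2 =
      Real.exp (2 * ((4 - 1 : ℕ) : ℝ) * δ) * Lf δ * Real.exp (2 * (2 * ((4 - 1 : ℕ) : ℝ) * δ)) := by
    rw [div_eq_mul_inv, ← Real.exp_nat_mul, ← Real.exp_neg]
    congr 2; push_cast; ring
  rw [hquot] at key
  have hVf0 : 0 ≤ ∫ σ, (f σ - ∫ τ, f τ ∂μ) ^ 2 ∂μ := integral_nonneg fun σ => sq_nonneg _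
  have hVh : ∫ η, (h η - ∫ τ, h τ ∂μ) ^ 2 ∂μ ≤ 1 / 4 * ∫ σ, (f σ - ∫ τ, f τ ∂μ) ^ 2 ∂μ := by
    have h1 : (1 - 9 * δ) * ∫ η, (h η - ∫ τ, h τ ∂μ) ^ 2 ∂μ ≤
        1 / 4 * (1 - 9 * δ) * ∫ σ, (f σ - ∫ τ, f τ ∂μ) ^ 2 ∂μ :=
      key.trans (mul_le_mul_of_nonneg_right hΨδ hVf0)
    have h2 : 0 < 1 - 9 * δ := by linarith
    nlinarith
  -- DLR: same mean, and `h` replaces `f` against `W`-blind statistics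
  have hmean : ∫ η, h η ∂μ = ∫ σ, f σ ∂μ := integral_kernelAvg hγ hGibbs W hfm hfC
  -- locality: the Markov property of the torus weight specification
  have hloc : DependsOn h (↑(plaqClosure W) : Set (Edge 4 (2 * S + 1))) := by
    have h1 := dependsOn_specAvg_torusWeightSpec (d := 4) (L := 2 * S + 1) hvc W hfm hfW
    exact h1
  refine ⟨h, hhm, hhC, hloc, fun g hgm ⟨Cg, hgC⟩ hgW => ?_, hmean, ?_⟩
  · have hsw : ∫ η, h η * g η ∂μ = ∫ σ, f σ * g σ ∂μ := integral_kernelAvg_mul hγ hGibbs W hfm hgm hfC hgC hgW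
    have hCf0 : 0 ≤ Cf := (abs_nonneg _).trans (hfC fun _ => 1)
    have hfg : Integrable (fun U => f U * g U) μ :=
      integrable_of_abs_le_const μ (hfm.mul hgm) (M := Cf * Cg) fun U => by
        rw [abs_mul]; exact mul_le_mul (hfC U) (hgC U) (abs_nonneg _) hCf0
    have hhg : Integrable (fun U => h U * g U) μ :=
      integrable_of_abs_le_const μ (hhm.mul hgm) (M := Cf * Cg) fun U => by
        rw [abs_mul]; exact mul_le_mul (hhC U) (hgC U) (abs_nonneg _) hCf0
    have hsplit : (fun U => (f U - h U) * g U) = fun U => f U * g U - h U * g U := by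
      funext U; ring
    rw [hsplit, integral_sub hfg hhg, hsw, sub_self]
  · rw [hmean] at hVh
    exact hVh

end Surrogate

/-! ## §3 The collar rung `stub_collarRungSC : CollarRungSC` -/

section Rung

/-- **The strong-coupling rung of the collar format (`CollarDecoupling.CollarRungSC`, skeleton stub `stub_collarRungSC` of the
collar line, merged into «maximal correlation at one physical thickness»), proved.**  For every compact simple `G`, lattice
representation `r` and `0 < β ≤ β_D(r)`: collar decoupling `CollarDecouplingAt r.ρ β 3` on every odd torus and every cube —
the surrogate of a statistic of `Λ_R(c)` is the kernel average over the links based in `Λ_{R+3}(c)` (`exists_strongCoupling_surrogate`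
with `W = cubeEdgesF S c (R+3)`), local in `Λ_{R+4}(c) ⊆ Λ_{R+5}(c)` by the plaquette closure, orthogonal to the exterior of
`Λ_{R+3}(c)` by DLR, with variance `≤ ¼` by the Dobrushin-uniqueness variance transfer.  Width `3` is what the stub asked; the
proof gives every width `≥ 1` verbatim.  Simplicity of `G` is not used (only metrisability via `r`).  HONEST: a SMALL-`β` witness
of the FORMAT; no evidence for the load `CollarSharpOnset` / `IRShellCorr`; nothing here bears on the Clay YM mass gap. -/
theorem stub_collarRungSC : CollarRungSC := by
  intro G _ _ _ _ _ r
  letI : MeasurableSpace G := borel G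
  haveI : BorelSpace G := ⟨rfl⟩
  haveI : SecondCountableTopology G :=
    (r.continuous.isClosedEmbedding r.injective).isEmbedding.secondCountableTopology
  haveI : T2Space G := (r.continuous.isClosedEmbedding r.injective).isEmbedding.t2Space
  obtain ⟨β₀, hβ₀, hsur⟩ := exists_strongCoupling_surrogate r.ρ r.continuous
  refine ⟨β₀, hβ₀, fun β hβpos hβle => ?_⟩
  have hβabs : |β| ≤ β₀ := by rw [abs_of_pos hβpos]; exact hβle
  intro S c R _hRS f hf
  obtain ⟨hfm, ⟨Cf, hfC⟩, hfdep⟩ := hf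
  have hfW : DependsOn f (↑(cubeEdgesF S c (R + 3)) : Set (Edge 4 (2 * S + 1))) := by
    rw [coe_cubeEdgesF]
    exact hfdep.mono (cubeEdges_mono S c (by omega))
  obtain ⟨f', hf'm, hf'C, hf'dep, horth, _hmean, hvar⟩ := hsur β hβabs S (cubeEdgesF S c (R + 3)) f hfm Cf hfC hfW
  refine ⟨f', ⟨hf'm, ⟨Cf, hf'C⟩, ?_⟩, fun h hh => ?_, hvar⟩
  · exact hf'dep.mono ((plaqClosure_cubeEdgesF_subset S c (R + 3)).trans (cubeEdges_mono S c (by omega)))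
  · obtain ⟨hhm, hhC, hhdep⟩ := hh
    refine horth h hhm hhC ?_
    rw [coe_cubeEdgesF]
    exact hhdep

end Rung

end Summit.QuantumFields.YangMills.Cruxes.IR.CollarDecoupling

end
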